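import Summits.HodgeConjecture.HodgeConjecture.Theorems.Ring2WeilCoverageTypeNormSignPrincipal
import Summits.HodgeConjecture.HodgeConjecture.Theorems.Ring2WeilCoverageRealUnitNormTwelve
import Summits.HodgeConjecture.HodgeConjecture.Theorems.Ring2WeilCoverageNonPrincipalLatticeLevel72
import Summits.HodgeConjecture.HodgeConjecture.Theorems.Ring2WeilCoverageNonPrincipalLatticeLevel52
import Summits.HodgeConjecture.HodgeConjecture.Theorems.Ring2WeilCoverageNonPrincipalLatticeRows
import Summits.HodgeConjecture.HodgeConjecture.Theorems.Ring2WeilCoverageCMTypeSetOddPositions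
import HarnessLib

/-!
# Weil-type family coverage — THE NORM-SIGN LAW ON THE NON-PRINCIPAL LATTICE CLASSES of `ℤ[ζ₇₂]` and `ℤ[ζ₅₂]` (`h = 3`):
# every polarisation type transfers between `ℂ^Φ/Φ(𝔪)` and `ℂ^Φ/Φ(ℤ[ζ_M])`, so at `72` type `(ϖ₀)` occurs on ALL THREE
# lattice classes iff `N(ϖ₀) > 0`, and at `52` whenever `N(ϖ₀) > 0`

research route conditional on HC_CM; not a corollary; Q11.4-sentence-2 already refuted in dim ≥ 3.

Ring 2, WEIL-TYPE FAMILY-COVERAGE CENSUS (`HOME/WEIL-FAMILY-COVERAGE.md` `## b01`, blocks b01.40 (the non-principal lattice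
classes at `52/72`: `h(ℚ(ζ_M)) = 3`, classes `[𝔬], [𝔔], [𝔔^ρ]` resp. `[𝔬], [𝔓], [𝔓^ρ]` with `𝔔𝔔^ρ = (α)`, `𝔓𝔓^ρ = (α)`,
`α ≫ 0`, PARI-certified class groups j215625) and b01.42 (the norm-sign law); owner ring2-b01), part 56h of the
`Ring2WeilCoverage*` series.  Part 45's transfer `exists_pos_isOfType_iff_of_totallyPositive` (for `𝔪𝔪^ρ = (α)`, `α`
totally positive, and ANY type `𝔣₀`: «type `𝔣₀` occurs on `ℂ^Φ/D(𝔪)`» ⟺ «type `𝔣₀` occurs on `ℂ^Φ/D(𝔬)`») carries parts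
56f/56g's rows from the principal torus to the two non-principal lattice classes of parts 46/47:

* `exists_type_iff_seventyTwo_nonprincipal` / `exists_type_iff_fiftyTwo_nonprincipal` — the transfer for every type `𝔣₀`
  on `𝔪 ∈ {𝔓, 𝔓^ρ}` resp. `{𝔔, 𝔔^ρ}` (every CM type `Φ`);
* level `72` (THEOREM L (i) by part 57, THEOREM L (ii) by part 19): **`exists_type_iff_norm_pos_seventyTwo_K_nonprincipal`**
  for `K = ℚ(i), ℚ(√−2), ℚ(√−3), ℚ(√−6)` — for every `K`-balanced `Φ`, every `𝔪 ∈ {𝔓, 𝔓^ρ}` and every real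
  `ϖ₀ ∈ 𝓞 K⁺ ∖ 0`: type `(ϖ₀)` occurs on `ℂ^Φ/Φ(𝔪)` ⟺ `N_{K⁺/ℚ}(ϖ₀) > 0`; and for EVERY `Φ`:
  `xor_principal_type_seventyTwo_nonprincipal_of_norm_neg` (`N(ϖ₀) < 0` ⇒ exactly one of «principal», «type `(ϖ₀)`» on
  `ℂ^Φ/Φ(𝔪)`);
* level `52` (THEOREM L (ii) only, part 18): **`exists_type_of_norm_pos_fiftyTwo_K_nonprincipal`** for `K = ℚ(i), ℚ(√−13)`:
  `N(ϖ₀) > 0` ⇒ type `(ϖ₀)` occurs on `ℂ^Φ/Φ(𝔔)` and `ℂ^Φ/Φ(𝔔^ρ)`.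

With parts 56f/56g (principal lattice) this covers EVERY simple CM torus `ℂ^Φ/Φ(𝔞)` with multiplication by the full ring
`ℤ[ζ₇₂]` resp. `ℤ[ζ₅₂]` and `K`-balanced `Φ` (three ideal classes each, b01.40 (C)).  HONEST FRAMING: torus-level statements
about Shimura's divisors of type `(K; Φ; 𝔣₀)` [Sh98 §14.3–14.4]; nothing here is a statement about Hodge classes, `W_K`,
general members or HC; `HC_CM` is used nowhere.  No `def`, no named fact, no `sorry`.

References: [cite: Shimura1998, §14.3 Prop. 4–5, pp. 103–104; §14.4 Prop. 7, p. 105]; census b01.40 / b01.42 (seat-derived).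
-/

noncomputable section

open Polynomial NumberField Complex Finset FractionalIdeal
open scoped Real nonZeroDivisors

namespace Summit.HodgeConjecture.Ring2WeilCoverage.TypeNormSignNonPrincipalLattices

open Literature.AlgebraicGeometry.Motives (CMType)
open Literature.AlgebraicGeometry.HodgeTheory (IsCMTypeSet)
open Literature.AlgebraicGeometry.ComplexMultiplication.CyclotomicCMType (isCMTypeSet_residueFilter)
open Literature.NumberTheory.ComplexMultiplication
open Summit.HodgeConjecture.Ring2WeilCoverage.TypeNormSign
open Summit.HodgeConjecture.Ring2WeilCoverage.CyclotomicDifferent (xi_ne_zero isOfType_one_xi_top)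
open Summit.HodgeConjecture.Ring2WeilCoverage.CyclotomicPrincipalObstruction (complexConj_xi)
open Summit.HodgeConjecture.Ring2WeilCoverage.CMTypeSetOddPositions (card_inter_nodd_mod_two_eq)
open Summit.HodgeConjecture.Ring2WeilCoverage.NonPrincipalLatticeRows (exists_pos_isOfType_iff_of_totallyPositive)
open Summit.HodgeConjecture.Ring2WeilCoverage.RealUnitNormTwelve (norm_realUnits_pos_seventyTwo)
open Summit.HodgeConjecture.Ring2WeilCoverage.CyclotomicSignaturesG12C (exists_units_sign_eq_seventyTwo)
open Summit.HodgeConjecture.Ring2WeilCoverage.CyclotomicSignaturesG12B (exists_units_sign_eq_fiftyTwo)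

variable {K : Type} [Field K] [NumberField K] [IsCMField K] {ζ : K}

/-- `𝐞(t) = exp(2πi t/n) ∈ ℂ` (`ZMod.toCircle`). -/
local notation3 (prettyPrint := false) "𝐞 " t:max => ((ZMod.toCircle t : Circle) : ℂ)

/-! ### Level `72`: the classes `[𝔓]`, `[𝔓^ρ]` -/

section Level72

/-- the residue set `S_Φ` read at level `72`. -/
local notation3 (prettyPrint := false) "SΦ72[" Φ "," z "]" =>
  (Finset.univ.filter fun t : ZMod 72 => ∃ σ ∈ (Φ : CMType K).1, σ (z : K) = 𝐞 t)
/-- part 47's lattice `𝔓 = (1 − ζ⁸, 1 + ζ⁹ + ζ²⁷) ⊂ 𝓞 K` (a prime over `3`). -/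
local notation3 (prettyPrint := false) "𝔓[" hζ "]" =>
  (Ideal.span {1 - IsPrimitiveRoot.toInteger hζ ^ 8,
    1 + IsPrimitiveRoot.toInteger hζ ^ 9 + IsPrimitiveRoot.toInteger hζ ^ 27} : Ideal (𝓞 K))
/-- its conjugate `𝔓^ρ = (1 − ζ⁶⁴, 1 + ζ⁶³ + ζ⁴⁵)`. -/
local notation3 (prettyPrint := false) "𝔓ρ[" hζ "]" =>
  (Ideal.span {1 - IsPrimitiveRoot.toInteger hζ ^ 64,
    1 + IsPrimitiveRoot.toInteger hζ ^ 63 + IsPrimitiveRoot.toInteger hζ ^ 45} : Ideal (𝓞 K))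

/-- **TRANSFER AT `72`, every type**: for `𝔪 ∈ {𝔓, 𝔓^ρ}` (`𝔪𝔪^ρ = (α)`, `α = u(20,8,58)u(3,15,63) ≫ 0`, part 47) and any type
`𝔣₀`, `ℂ^Φ/D(𝔪)` carries a `Φ`-positive divisor of type `𝔣₀` iff `ℂ^Φ/Φ(ℤ[ζ₇₂])` does (part 45's twist transfer with
`Φ_α = Φ`).
research route conditional on HC_CM; not a corollary; Q11.4-sentence-2 already refuted in dim ≥ 3. [cite: Shimura1998, §14.3 Prop. 4–5, pp. 103–104; §14.4 Prop. 7, p. 105] -/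
theorem exists_type_iff_seventyTwo_nonprincipal (hζ : IsPrimitiveRoot ζ 72) (Φ : CMType K)
    (𝔪 : (FractionalIdeal (𝓞 K)⁰ K)ˣ)
    (h : (𝔪 : FractionalIdeal (𝓞 K)⁰ K) = ((𝔓[hζ] : Ideal (𝓞 K)) : FractionalIdeal (𝓞 K)⁰ K) ∨
      (𝔪 : FractionalIdeal (𝓞 K)⁰ K) = ((𝔓ρ[hζ] : Ideal (𝓞 K)) : FractionalIdeal (𝓞 K)⁰ K))
    (𝔣₀ : Ideal (𝓞 (maximalRealSubfield K))) :
    (∃ ζ' : K, IsCMField.complexConj K ζ' = -ζ' ∧ (∀ φ : Φ.1, 0 < (φ.1 ζ').im) ∧ CMTypeLattice.IsOfType 𝔪 ζ' 𝔣₀) ↔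
      ∃ ζ' : K, IsCMField.complexConj K ζ' = -ζ' ∧ (∀ φ : Φ.1, 0 < (φ.1 ζ').im) ∧
        CMTypeLattice.IsOfType (1 : (FractionalIdeal (𝓞 K)⁰ K)ˣ) ζ' 𝔣₀ :=
  exists_pos_isOfType_iff_of_totallyPositive Φ 𝔪 (NonPrincipalLatticeLevel72.alpha_real_pos hζ).1
    (NonPrincipalLatticeLevel72.alpha_real_pos hζ).2 (NonPrincipalLatticeLevel72.mul_conjIdeal_eq_of_coe_eq hζ 𝔪 h) 𝔣₀

open scoped Classical in
/-- **ROW `(ℚ(ζ₇₂), ℚ(i))` ON THE NON-PRINCIPAL CLASSES — THE TYPE SPECTRUM**: for every CM type `Φ` balanced for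
`N_K = [7, 11, 19, 23, 31, 35, 43, 47, 55, 59, 67, 71]`, every `𝔪 ∈ {𝔓, 𝔓^ρ}` and every real `ϖ₀ ∈ 𝓞 K⁺ ∖ 0`: `ℂ^Φ/Φ(𝔪)` carries a `Φ`-positive divisor of type
`(ϖ₀)` **iff `N_{K⁺/ℚ}(ϖ₀) > 0`** (transfer + the principal-lattice row: part 55b `exists_type_span_iff_norm_pos_of_even`,
THEOREM L (i) at `72` by part 57, THEOREM L (ii) by part 19, `n₋ = 6 ≡ 0`).
research route conditional on HC_CM; not a corollary; Q11.4-sentence-2 already refuted in dim ≥ 3. [cite: Shimura1998, §14.3 Prop. 4–5, pp. 103–104; §14.4 Prop. 7, p. 105] -/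
theorem exists_type_iff_norm_pos_seventyTwo_sqrt_neg_one_nonprincipal [IsCyclotomicExtension {72} ℚ K]
    (hζ : IsPrimitiveRoot ζ 72) (Φ : CMType K)
    (hbal : 2 * (SΦ72[Φ, ζ] ∩ ({7, 11, 19, 23, 31, 35, 43, 47, 55, 59, 67, 71} : Finset (ZMod 72))).card = (SΦ72[Φ, ζ]).card)
    (𝔪 : (FractionalIdeal (𝓞 K)⁰ K)ˣ)
    (h : (𝔪 : FractionalIdeal (𝓞 K)⁰ K) = ((𝔓[hζ] : Ideal (𝓞 K)) : FractionalIdeal (𝓞 K)⁰ K) ∨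
      (𝔪 : FractionalIdeal (𝓞 K)⁰ K) = ((𝔓ρ[hζ] : Ideal (𝓞 K)) : FractionalIdeal (𝓞 K)⁰ K))
    {ϖ₀ : 𝓞 (maximalRealSubfield K)} (hϖ0 : ϖ₀ ≠ 0) :
    (∃ ζ' : K, IsCMField.complexConj K ζ' = -ζ' ∧ (∀ φ : Φ.1, 0 < (φ.1 ζ').im) ∧
        CMTypeLattice.IsOfType 𝔪 ζ' (Ideal.span {ϖ₀})) ↔
      0 < Algebra.norm ℚ ((ϖ₀ : maximalRealSubfield K)) := by
  rw [exists_type_iff_seventyTwo_nonprincipal hζ Φ 𝔪 h (Ideal.span {ϖ₀})]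
  have hg : Nat.totient 72 = 2 * (11 + 1) := by decide
  refine exists_type_span_iff_norm_pos_of_even hζ hg Φ hϖ0 (norm_realUnits_pos_seventyTwo hζ)
    (exists_units_sign_eq_seventyTwo hζ Φ) ?_
  have hS := isCMTypeSet_residueFilter hζ Φ
  have hNK : IsCMTypeSet 72 ({7, 11, 19, 23, 31, 35, 43, 47, 55, 59, 67, 71} : Finset (ZMod 72)) := by decide
  have h' := card_inter_nodd_mod_two_eq (m := 72) (by norm_num) hS hNK hbal
  have hn : ((({7, 11, 19, 23, 31, 35, 43, 47, 55, 59, 67, 71} : Finset (ZMod 72))).filter fun t : ZMod 72 => 2 * t.val < 72).card % 2 = 0 := by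
    decide
  rw [hn] at h'
  exact Nat.even_iff.mpr h'

open scoped Classical in
/-- **ROW `(ℚ(ζ₇₂), ℚ(√−2))` ON THE NON-PRINCIPAL CLASSES — THE TYPE SPECTRUM**: for every CM type `Φ` balanced for
`N_K = [5, 7, 13, 23, 29, 31, 37, 47, 53, 55, 61, 71]`, every `𝔪 ∈ {𝔓, 𝔓^ρ}` and every real `ϖ₀ ∈ 𝓞 K⁺ ∖ 0`: `ℂ^Φ/Φ(𝔪)` carries a `Φ`-positive divisor of type
`(ϖ₀)` **iff `N_{K⁺/ℚ}(ϖ₀) > 0`** (transfer + the principal-lattice row: part 55b `exists_type_span_iff_norm_pos_of_even`,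
THEOREM L (i) at `72` by part 57, THEOREM L (ii) by part 19, `n₋ = 6 ≡ 0`).
research route conditional on HC_CM; not a corollary; Q11.4-sentence-2 already refuted in dim ≥ 3. [cite: Shimura1998, §14.3 Prop. 4–5, pp. 103–104; §14.4 Prop. 7, p. 105] -/
theorem exists_type_iff_norm_pos_seventyTwo_sqrt_neg_two_nonprincipal [IsCyclotomicExtension {72} ℚ K]
    (hζ : IsPrimitiveRoot ζ 72) (Φ : CMType K)
    (hbal : 2 * (SΦ72[Φ, ζ] ∩ ({5, 7, 13, 23, 29, 31, 37, 47, 53, 55, 61, 71} : Finset (ZMod 72))).card = (SΦ72[Φ, ζ]).card)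
    (𝔪 : (FractionalIdeal (𝓞 K)⁰ K)ˣ)
    (h : (𝔪 : FractionalIdeal (𝓞 K)⁰ K) = ((𝔓[hζ] : Ideal (𝓞 K)) : FractionalIdeal (𝓞 K)⁰ K) ∨
      (𝔪 : FractionalIdeal (𝓞 K)⁰ K) = ((𝔓ρ[hζ] : Ideal (𝓞 K)) : FractionalIdeal (𝓞 K)⁰ K))
    {ϖ₀ : 𝓞 (maximalRealSubfield K)} (hϖ0 : ϖ₀ ≠ 0) :
    (∃ ζ' : K, IsCMField.complexConj K ζ' = -ζ' ∧ (∀ φ : Φ.1, 0 < (φ.1 ζ').im) ∧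
        CMTypeLattice.IsOfType 𝔪 ζ' (Ideal.span {ϖ₀})) ↔
      0 < Algebra.norm ℚ ((ϖ₀ : maximalRealSubfield K)) := by
  rw [exists_type_iff_seventyTwo_nonprincipal hζ Φ 𝔪 h (Ideal.span {ϖ₀})]
  have hg : Nat.totient 72 = 2 * (11 + 1) := by decide
  refine exists_type_span_iff_norm_pos_of_even hζ hg Φ hϖ0 (norm_realUnits_pos_seventyTwo hζ)
    (exists_units_sign_eq_seventyTwo hζ Φ) ?_
  have hS := isCMTypeSet_residueFilter hζ Φ
  have hNK : IsCMTypeSet 72 ({5, 7, 13, 23, 29, 31, 37, 47, 53, 55, 61, 71} : Finset (ZMod 72)) := by decide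
  have h' := card_inter_nodd_mod_two_eq (m := 72) (by norm_num) hS hNK hbal
  have hn : ((({5, 7, 13, 23, 29, 31, 37, 47, 53, 55, 61, 71} : Finset (ZMod 72))).filter fun t : ZMod 72 => 2 * t.val < 72).card % 2 = 0 := by
    decide
  rw [hn] at h'
  exact Nat.even_iff.mpr h'

open scoped Classical in
/-- **ROW `(ℚ(ζ₇₂), ℚ(√−3))` ON THE NON-PRINCIPAL CLASSES — THE TYPE SPECTRUM**: for every CM type `Φ` balanced for
`N_K = [5, 11, 17, 23, 29, 35, 41, 47, 53, 59, 65, 71]`, every `𝔪 ∈ {𝔓, 𝔓^ρ}` and every real `ϖ₀ ∈ 𝓞 K⁺ ∖ 0`: `ℂ^Φ/Φ(𝔪)` carries a `Φ`-positive divisor of type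
`(ϖ₀)` **iff `N_{K⁺/ℚ}(ϖ₀) > 0`** (transfer + the principal-lattice row: part 55b `exists_type_span_iff_norm_pos_of_even`,
THEOREM L (i) at `72` by part 57, THEOREM L (ii) by part 19, `n₋ = 6 ≡ 0`).
research route conditional on HC_CM; not a corollary; Q11.4-sentence-2 already refuted in dim ≥ 3. [cite: Shimura1998, §14.3 Prop. 4–5, pp. 103–104; §14.4 Prop. 7, p. 105] -/
theorem exists_type_iff_norm_pos_seventyTwo_sqrt_neg_three_nonprincipal [IsCyclotomicExtension {72} ℚ K]
    (hζ : IsPrimitiveRoot ζ 72) (Φ : CMType K)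
    (hbal : 2 * (SΦ72[Φ, ζ] ∩ ({5, 11, 17, 23, 29, 35, 41, 47, 53, 59, 65, 71} : Finset (ZMod 72))).card = (SΦ72[Φ, ζ]).card)
    (𝔪 : (FractionalIdeal (𝓞 K)⁰ K)ˣ)
    (h : (𝔪 : FractionalIdeal (𝓞 K)⁰ K) = ((𝔓[hζ] : Ideal (𝓞 K)) : FractionalIdeal (𝓞 K)⁰ K) ∨
      (𝔪 : FractionalIdeal (𝓞 K)⁰ K) = ((𝔓ρ[hζ] : Ideal (𝓞 K)) : FractionalIdeal (𝓞 K)⁰ K))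
    {ϖ₀ : 𝓞 (maximalRealSubfield K)} (hϖ0 : ϖ₀ ≠ 0) :
    (∃ ζ' : K, IsCMField.complexConj K ζ' = -ζ' ∧ (∀ φ : Φ.1, 0 < (φ.1 ζ').im) ∧
        CMTypeLattice.IsOfType 𝔪 ζ' (Ideal.span {ϖ₀})) ↔
      0 < Algebra.norm ℚ ((ϖ₀ : maximalRealSubfield K)) := by
  rw [exists_type_iff_seventyTwo_nonprincipal hζ Φ 𝔪 h (Ideal.span {ϖ₀})]
  have hg : Nat.totient 72 = 2 * (11 + 1) := by decide
  refine exists_type_span_iff_norm_pos_of_even hζ hg Φ hϖ0 (norm_realUnits_pos_seventyTwo hζ)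
    (exists_units_sign_eq_seventyTwo hζ Φ) ?_
  have hS := isCMTypeSet_residueFilter hζ Φ
  have hNK : IsCMTypeSet 72 ({5, 11, 17, 23, 29, 35, 41, 47, 53, 59, 65, 71} : Finset (ZMod 72)) := by decide
  have h' := card_inter_nodd_mod_two_eq (m := 72) (by norm_num) hS hNK hbal
  have hn : ((({5, 11, 17, 23, 29, 35, 41, 47, 53, 59, 65, 71} : Finset (ZMod 72))).filter fun t : ZMod 72 => 2 * t.val < 72).card % 2 = 0 := by
    decide
  rw [hn] at h'
  exact Nat.even_iff.mpr h'

open scoped Classical in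
/-- **ROW `(ℚ(ζ₇₂), ℚ(√−6))` ON THE NON-PRINCIPAL CLASSES — THE TYPE SPECTRUM**: for every CM type `Φ` balanced for
`N_K = [13, 17, 19, 23, 37, 41, 43, 47, 61, 65, 67, 71]`, every `𝔪 ∈ {𝔓, 𝔓^ρ}` and every real `ϖ₀ ∈ 𝓞 K⁺ ∖ 0`: `ℂ^Φ/Φ(𝔪)` carries a `Φ`-positive divisor of type
`(ϖ₀)` **iff `N_{K⁺/ℚ}(ϖ₀) > 0`** (transfer + the principal-lattice row: part 55b `exists_type_span_iff_norm_pos_of_even`,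
THEOREM L (i) at `72` by part 57, THEOREM L (ii) by part 19, `n₋ = 4 ≡ 0`).
research route conditional on HC_CM; not a corollary; Q11.4-sentence-2 already refuted in dim ≥ 3. [cite: Shimura1998, §14.3 Prop. 4–5, pp. 103–104; §14.4 Prop. 7, p. 105] -/
theorem exists_type_iff_norm_pos_seventyTwo_sqrt_neg_six_nonprincipal [IsCyclotomicExtension {72} ℚ K]
    (hζ : IsPrimitiveRoot ζ 72) (Φ : CMType K)
    (hbal : 2 * (SΦ72[Φ, ζ] ∩ ({13, 17, 19, 23, 37, 41, 43, 47, 61, 65, 67, 71} : Finset (ZMod 72))).card = (SΦ72[Φ, ζ]).card)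
    (𝔪 : (FractionalIdeal (𝓞 K)⁰ K)ˣ)
    (h : (𝔪 : FractionalIdeal (𝓞 K)⁰ K) = ((𝔓[hζ] : Ideal (𝓞 K)) : FractionalIdeal (𝓞 K)⁰ K) ∨
      (𝔪 : FractionalIdeal (𝓞 K)⁰ K) = ((𝔓ρ[hζ] : Ideal (𝓞 K)) : FractionalIdeal (𝓞 K)⁰ K))
    {ϖ₀ : 𝓞 (maximalRealSubfield K)} (hϖ0 : ϖ₀ ≠ 0) :
    (∃ ζ' : K, IsCMField.complexConj K ζ' = -ζ' ∧ (∀ φ : Φ.1, 0 < (φ.1 ζ').im) ∧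
        CMTypeLattice.IsOfType 𝔪 ζ' (Ideal.span {ϖ₀})) ↔
      0 < Algebra.norm ℚ ((ϖ₀ : maximalRealSubfield K)) := by
  rw [exists_type_iff_seventyTwo_nonprincipal hζ Φ 𝔪 h (Ideal.span {ϖ₀})]
  have hg : Nat.totient 72 = 2 * (11 + 1) := by decide
  refine exists_type_span_iff_norm_pos_of_even hζ hg Φ hϖ0 (norm_realUnits_pos_seventyTwo hζ)
    (exists_units_sign_eq_seventyTwo hζ Φ) ?_
  have hS := isCMTypeSet_residueFilter hζ Φ
  have hNK : IsCMTypeSet 72 ({13, 17, 19, 23, 37, 41, 43, 47, 61, 65, 67, 71} : Finset (ZMod 72)) := by decide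
  have h' := card_inter_nodd_mod_two_eq (m := 72) (by norm_num) hS hNK hbal
  have hn : ((({13, 17, 19, 23, 37, 41, 43, 47, 61, 65, 67, 71} : Finset (ZMod 72))).filter fun t : ZMod 72 => 2 * t.val < 72).card % 2 = 0 := by
    decide
  rw [hn] at h'
  exact Nat.even_iff.mpr h'

/-- **DICHOTOMY ON THE NON-PRINCIPAL CLASSES AT `72`**: for EVERY CM type `Φ`, every `𝔪 ∈ {𝔓, 𝔓^ρ}` and every
`ϖ₀ ∈ 𝓞 K⁺` with `N_{K⁺/ℚ}(ϖ₀) < 0`, `ℂ^Φ/Φ(𝔪)` carries EITHER an `ι`-compatible principal polarisation OR a `Φ`-positive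
divisor of type `(ϖ₀)`, never both (both sides transfer to the principal torus, where part 55b's
`xor_principal_span_of_norm_neg` applies with THEOREM L (i)/(ii) at `72`).
research route conditional on HC_CM; not a corollary; Q11.4-sentence-2 already refuted in dim ≥ 3. [cite: Shimura1998, §14.3 Prop. 4–5, pp. 103–104; §14.4 Prop. 7, p. 105] -/
theorem xor_principal_type_seventyTwo_nonprincipal_of_norm_neg [IsCyclotomicExtension {72} ℚ K]
    (hζ : IsPrimitiveRoot ζ 72) (Φ : CMType K) (𝔪 : (FractionalIdeal (𝓞 K)⁰ K)ˣ)
    (h : (𝔪 : FractionalIdeal (𝓞 K)⁰ K) = ((𝔓[hζ] : Ideal (𝓞 K)) : FractionalIdeal (𝓞 K)⁰ K) ∨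
      (𝔪 : FractionalIdeal (𝓞 K)⁰ K) = ((𝔓ρ[hζ] : Ideal (𝓞 K)) : FractionalIdeal (𝓞 K)⁰ K))
    {ϖ₀ : 𝓞 (maximalRealSubfield K)} (hneg : Algebra.norm ℚ ((ϖ₀ : maximalRealSubfield K)) < 0) :
    Xor (∃ ζ' : K, IsCMField.complexConj K ζ' = -ζ' ∧ (∀ φ : Φ.1, 0 < (φ.1 ζ').im) ∧ CMTypeLattice.IsOfType 𝔪 ζ' ⊤)
      (∃ ζ' : K, IsCMField.complexConj K ζ' = -ζ' ∧ (∀ φ : Φ.1, 0 < (φ.1 ζ').im) ∧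
        CMTypeLattice.IsOfType 𝔪 ζ' (Ideal.span {ϖ₀})) := by
  rw [exists_type_iff_seventyTwo_nonprincipal hζ Φ 𝔪 h ⊤,
    exists_type_iff_seventyTwo_nonprincipal hζ Φ 𝔪 h (Ideal.span {ϖ₀})]
  have hg : Nat.totient 72 = 2 * (11 + 1) := by decide
  exact xor_principal_span_of_norm_neg Φ 1 (complexConj_xi hζ hg) (xi_ne_zero hζ 11) (isOfType_one_xi_top hζ 11) hneg
    (norm_realUnits_pos_seventyTwo hζ) (exists_units_sign_eq_seventyTwo hζ Φ)

end Level72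

/-! ### Level `52`: the classes `[𝔔]`, `[𝔔^ρ]` (THEOREM L (ii) only) -/

section Level52

/-- the residue set `S_Φ` read at level `52`. -/
local notation3 (prettyPrint := false) "SΦ52[" Φ "," z "]" =>
  (Finset.univ.filter fun t : ZMod 52 => ∃ σ ∈ (Φ : CMType K).1, σ (z : K) = 𝐞 t)
/-- part 46's lattice `𝔔 = (1 − ζ⁴, 3 + 2ζ¹³) ⊂ 𝓞 K` (a prime over `13`). -/
local notation3 (prettyPrint := false) "𝔔[" hζ "]" =>
  (Ideal.span {1 - IsPrimitiveRoot.toInteger hζ ^ 4, 3 + 2 * IsPrimitiveRoot.toInteger hζ ^ 13} : Ideal (𝓞 K))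
/-- its conjugate `𝔔^ρ = (1 − ζ⁴⁸, 3 + 2ζ³⁹)`. -/
local notation3 (prettyPrint := false) "𝔔ρ[" hζ "]" =>
  (Ideal.span {1 - IsPrimitiveRoot.toInteger hζ ^ 48, 3 + 2 * IsPrimitiveRoot.toInteger hζ ^ 39} : Ideal (𝓞 K))

/-- **TRANSFER AT `52`, every type**: for `𝔪 ∈ {𝔔, 𝔔^ρ}` (`𝔪𝔪^ρ = (α)`, `α ≫ 0`, part 46) and any type `𝔣₀`, `ℂ^Φ/D(𝔪)`
carries a `Φ`-positive divisor of type `𝔣₀` iff `ℂ^Φ/Φ(ℤ[ζ₅₂])` does.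
research route conditional on HC_CM; not a corollary; Q11.4-sentence-2 already refuted in dim ≥ 3. [cite: Shimura1998, §14.3 Prop. 4–5, pp. 103–104; §14.4 Prop. 7, p. 105] -/
theorem exists_type_iff_fiftyTwo_nonprincipal (hζ : IsPrimitiveRoot ζ 52) (Φ : CMType K)
    (𝔪 : (FractionalIdeal (𝓞 K)⁰ K)ˣ)
    (h : (𝔪 : FractionalIdeal (𝓞 K)⁰ K) = ((𝔔[hζ] : Ideal (𝓞 K)) : FractionalIdeal (𝓞 K)⁰ K) ∨
      (𝔪 : FractionalIdeal (𝓞 K)⁰ K) = ((𝔔ρ[hζ] : Ideal (𝓞 K)) : FractionalIdeal (𝓞 K)⁰ K))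
    (𝔣₀ : Ideal (𝓞 (maximalRealSubfield K))) :
    (∃ ζ' : K, IsCMField.complexConj K ζ' = -ζ' ∧ (∀ φ : Φ.1, 0 < (φ.1 ζ').im) ∧ CMTypeLattice.IsOfType 𝔪 ζ' 𝔣₀) ↔
      ∃ ζ' : K, IsCMField.complexConj K ζ' = -ζ' ∧ (∀ φ : Φ.1, 0 < (φ.1 ζ').im) ∧
        CMTypeLattice.IsOfType (1 : (FractionalIdeal (𝓞 K)⁰ K)ˣ) ζ' 𝔣₀ := by
  rcases h with h | h
  · exact exists_pos_isOfType_iff_of_totallyPositive Φ 𝔪 (NonPrincipalLatticeLevel52.alpha_real_pos hζ).1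
      (NonPrincipalLatticeLevel52.alpha_real_pos hζ).2 (NonPrincipalLatticeLevel52.mul_conjIdeal_eq_of_coe_eq hζ 𝔪 h) 𝔣₀
  · exact exists_pos_isOfType_iff_of_totallyPositive Φ 𝔪 (NonPrincipalLatticeLevel52.alpha_real_pos hζ).1
      (NonPrincipalLatticeLevel52.alpha_real_pos hζ).2
      (NonPrincipalLatticeLevel52.mul_conjIdeal_eq_of_coe_eq_conj hζ 𝔪 h) 𝔣₀

open scoped Classical in
/-- **ROW `(ℚ(ζ₅₂), ℚ(i))` ON THE NON-PRINCIPAL CLASSES — every type of positive norm occurs**: for every CM type `Φ`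
balanced for `N_K = [3, 7, 11, 15, 19, 23, 27, 31, 35, 43, 47, 51]`, every `𝔪 ∈ {𝔔, 𝔔^ρ}` and every `ϖ₀ ∈ 𝓞 K⁺` with `N_{K⁺/ℚ}(ϖ₀) > 0`: `ℂ^Φ/Φ(𝔪)`
carries a `Φ`-positive divisor of type `(ϖ₀)` (transfer + part 55b `exists_type_span_of_even_iff` with THEOREM L (ii) at `52`,
`n₋ = 6 ≡ 0`; THEOREM L (i) at `52` is not in the tree, so the converse is not claimed).
research route conditional on HC_CM; not a corollary; Q11.4-sentence-2 already refuted in dim ≥ 3. [cite: Shimura1998, §14.3 Prop. 4–5, pp. 103–104; §14.4 Prop. 7, p. 105] -/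
theorem exists_type_of_norm_pos_fiftyTwo_sqrt_neg_one_nonprincipal [IsCyclotomicExtension {52} ℚ K]
    (hζ : IsPrimitiveRoot ζ 52) (Φ : CMType K)
    (hbal : 2 * (SΦ52[Φ, ζ] ∩ ({3, 7, 11, 15, 19, 23, 27, 31, 35, 43, 47, 51} : Finset (ZMod 52))).card = (SΦ52[Φ, ζ]).card)
    (𝔪 : (FractionalIdeal (𝓞 K)⁰ K)ˣ)
    (h : (𝔪 : FractionalIdeal (𝓞 K)⁰ K) = ((𝔔[hζ] : Ideal (𝓞 K)) : FractionalIdeal (𝓞 K)⁰ K) ∨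
      (𝔪 : FractionalIdeal (𝓞 K)⁰ K) = ((𝔔ρ[hζ] : Ideal (𝓞 K)) : FractionalIdeal (𝓞 K)⁰ K))
    {ϖ₀ : 𝓞 (maximalRealSubfield K)} (hpos : 0 < Algebra.norm ℚ ((ϖ₀ : maximalRealSubfield K))) :
    ∃ ζ' : K, IsCMField.complexConj K ζ' = -ζ' ∧ (∀ φ : Φ.1, 0 < (φ.1 ζ').im) ∧
        CMTypeLattice.IsOfType 𝔪 ζ' (Ideal.span {ϖ₀}) := by
  rw [exists_type_iff_fiftyTwo_nonprincipal hζ Φ 𝔪 h (Ideal.span {ϖ₀})]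
  have hg : Nat.totient 52 = 2 * (11 + 1) := by decide
  have hϖ0 : ϖ₀ ≠ 0 := by
    rintro rfl
    simp at hpos
  refine exists_type_span_of_even_iff hζ hg Φ hϖ0 (exists_units_sign_eq_fiftyTwo hζ Φ) ?_
  have hS := isCMTypeSet_residueFilter hζ Φ
  have hNK : IsCMTypeSet 52 ({3, 7, 11, 15, 19, 23, 27, 31, 35, 43, 47, 51} : Finset (ZMod 52)) := by decide
  have h' := card_inter_nodd_mod_two_eq (m := 52) (by norm_num) hS hNK hbal
  have hn : ((({3, 7, 11, 15, 19, 23, 27, 31, 35, 43, 47, 51} : Finset (ZMod 52))).filter fun t : ZMod 52 => 2 * t.val < 52).card % 2 = 0 := by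
    decide
  rw [hn] at h'
  exact ⟨fun _ => hpos, fun _ => Nat.even_iff.mpr h'⟩

open scoped Classical in
/-- **ROW `(ℚ(ζ₅₂), ℚ(√−13))` ON THE NON-PRINCIPAL CLASSES — every type of positive norm occurs**: for every CM type `Φ`
balanced for `N_K = [3, 5, 21, 23, 27, 33, 35, 37, 41, 43, 45, 51]`, every `𝔪 ∈ {𝔔, 𝔔^ρ}` and every `ϖ₀ ∈ 𝓞 K⁺` with `N_{K⁺/ℚ}(ϖ₀) > 0`: `ℂ^Φ/Φ(𝔪)`
carries a `Φ`-positive divisor of type `(ϖ₀)` (transfer + part 55b `exists_type_span_of_even_iff` with THEOREM L (ii) at `52`,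
`n₋ = 4 ≡ 0`; THEOREM L (i) at `52` is not in the tree, so the converse is not claimed).
research route conditional on HC_CM; not a corollary; Q11.4-sentence-2 already refuted in dim ≥ 3. [cite: Shimura1998, §14.3 Prop. 4–5, pp. 103–104; §14.4 Prop. 7, p. 105] -/
theorem exists_type_of_norm_pos_fiftyTwo_sqrt_neg_thirteen_nonprincipal [IsCyclotomicExtension {52} ℚ K]
    (hζ : IsPrimitiveRoot ζ 52) (Φ : CMType K)
    (hbal : 2 * (SΦ52[Φ, ζ] ∩ ({3, 5, 21, 23, 27, 33, 35, 37, 41, 43, 45, 51} : Finset (ZMod 52))).card = (SΦ52[Φ, ζ]).card)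
    (𝔪 : (FractionalIdeal (𝓞 K)⁰ K)ˣ)
    (h : (𝔪 : FractionalIdeal (𝓞 K)⁰ K) = ((𝔔[hζ] : Ideal (𝓞 K)) : FractionalIdeal (𝓞 K)⁰ K) ∨
      (𝔪 : FractionalIdeal (𝓞 K)⁰ K) = ((𝔔ρ[hζ] : Ideal (𝓞 K)) : FractionalIdeal (𝓞 K)⁰ K))
    {ϖ₀ : 𝓞 (maximalRealSubfield K)} (hpos : 0 < Algebra.norm ℚ ((ϖ₀ : maximalRealSubfield K))) :
    ∃ ζ' : K, IsCMField.complexConj K ζ' = -ζ' ∧ (∀ φ : Φ.1, 0 < (φ.1 ζ').im) ∧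
        CMTypeLattice.IsOfType 𝔪 ζ' (Ideal.span {ϖ₀}) := by
  rw [exists_type_iff_fiftyTwo_nonprincipal hζ Φ 𝔪 h (Ideal.span {ϖ₀})]
  have hg : Nat.totient 52 = 2 * (11 + 1) := by decide
  have hϖ0 : ϖ₀ ≠ 0 := by
    rintro rfl
    simp at hpos
  refine exists_type_span_of_even_iff hζ hg Φ hϖ0 (exists_units_sign_eq_fiftyTwo hζ Φ) ?_
  have hS := isCMTypeSet_residueFilter hζ Φ
  have hNK : IsCMTypeSet 52 ({3, 5, 21, 23, 27, 33, 35, 37, 41, 43, 45, 51} : Finset (ZMod 52)) := by decide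
  have h' := card_inter_nodd_mod_two_eq (m := 52) (by norm_num) hS hNK hbal
  have hn : ((({3, 5, 21, 23, 27, 33, 35, 37, 41, 43, 45, 51} : Finset (ZMod 52))).filter fun t : ZMod 52 => 2 * t.val < 52).card % 2 = 0 := by
    decide
  rw [hn] at h'
  exact ⟨fun _ => hpos, fun _ => Nat.even_iff.mpr h'⟩

end Level52

end Summit.HodgeConjecture.Ring2WeilCoverage.TypeNormSignNonPrincipalLattices

end
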